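import Summits.QuantumFields.YangMills.Theorems.BalabanUVNodesN21ReadSetSupport
import Literature.MathematicalPhysics.QuantumFieldTheory.Balaban1983to89.Node00.LargeFieldTowerOfRecord
import Literature.MathematicalPhysics.QuantumFieldTheory.Balaban1983to89.B14SeparationOfRecord

/-!
# N21 (NE7c), strategy s3 «alternative currency», file 31 — THE (DISJ) SUPPORT LEMMA, part 2: the read set of the (2.16) local minimiser
# `liftIter k (inputs (near 𝐁_k(□_c^{≈4})))` is CARRIED BY `□_c^{≈7}`, hence file 28 ∕ 29's displayed binder `hdisj` ∕ `hoff` is DISCHARGED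
# for every fibre of def-R's shape `fib ⊆ bondsMeeting k Z` (`fibOfSeq = bondsMeeting k Z′(s)`) on every cube whose `□^{≈7}` misses `Z`

HEADER — WORK-UNIT METADATA.  Seat `pub-ymgap-dag-n21-e` (R141 (C) fan-out, node N21 = NE7c, strategy s3), g10, file 31; sequel of file 30
(`…N21ReadSetSupport`: torus collars, blocks, `src_mem_collar_of_inputs_near_Bj`), of file 29 (`…N21ChiSlotCubeGeometry`, p531762: (G5′) ∕ (G5″)
modulo (DISJ)) and of file 28 (`…RStepLocalityBgN`, p529659).  Lane: `--kind proof --supports stmt-QuantumFields-20509 --as helper` (K3⁶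
`SpineGivenEndpointR13SepCoPR`, dag-lead WORDS-142 ∕ director-ym №179).  Count-neutral.

THE CONTENT ([folklore] lattice geometry; collars typed torus-honestly as `cover P '' cubeExt s c w`, file 30).
§4 The read set: by 29 (G6) every bond of `liftIter k S` is `⟨B^k(b₀₋), μ(b₀)⟩`, `b₀ ∈ S`; with 30's `src_mem_collar_of_inputs_near_Bj`, the block spread
   `L^k − 1` (30 `within_lift_of_blockIter_eq`) and the `L^k`-translate (30 `blockIter_cover_sub_single`), EVERY FINE POINT OF THE `k`-BLOCK OF EITHER
   ENDPOINT of a read bond of `liftIter k (inputs (near 𝐁_k(Ω)))`, `Ω = π(cubeExt s c w)`, lies in `π(cubeExt s c (w + 6L^k − 2))`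
   (`block_mem_collar_of_liftIter`); with `w = 4s` and `2L^k ≤ s`: ★★ `readSet_block_subset_cubeEnl` — the read set of (2.16) is carried by
   `□_c^{≈7} = cubeEnl s c 7` (def-R's `cubeEnl` IS the pushed-forward collar, `cubeEnl_eq`; def-R's `Node00.blockIter` IS r11's, `node00_blockIter_eq`);
   and the (DISJ) DISCHARGE ★★ `not_mem_of_far`: a fibre `fib ⊆ bondsMeeting k Z` misses the read set of every cube with `Z ∩ □_c^{≈7} = ∅`.
§5 At the record (`s = L^{k+1}M₂R_k ≥ 2L^k` from `1 ≤ M₂`: `B14SeparationOfRecord.one_le_RkOfRecord` by name, `two_mul_pow_le_cubeSide`): 29 (G5′) ∕ (G5″) with `hdisj` ∕ `hoff`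
   GONE in favour of the geometric OFF-set «`On` contains every cube whose `□^{≈7}` meets `Z`» (★ `fibreIndep_recordStatN_of_far`,
   ★★ `fibreIndep_chiSeqN_off_of_far`); def-R's `fibOfSeq` read as such a fibre (`mem_bondsMeeting_of_mem_fibOfSeq`) and the one application
   ★★ `fibreIndep_chiSeqN_off_of_far_fibOfSeq` (`fib := fibOfSeq …`, `Z := Z′(sq) = zpOfSeq …`).

HONEST FRAMING.  NE7c is NOT PRINTED and NOT PROVED.  This file discharges the (DISJ) side condition of the (LOC) road (22c ∕ 28 ∕ 29): KT-28's
(LOC) at `𝔟ᴺ` now holds modulo the numerics binders `0 < k ≤ m + K`, `1 ≤ M₁`, `1 ≤ M₂`, `L·M₁ ≤ L^{k+1}M₂R_k` ONLY, with the OFF-set READ OFF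
THE GEOMETRY (`□_c^{≈7} ∩ Z′ = ∅`).  The collar `7` is this lineage's honest constant for print's *«U_{k,□} depends on V_k restricted to □^{≈4}»*
((2.16) p. 257: print's `□^{≈4}` carries the DATA; the bond variables read through `Q_k^{s*}` and the averages `M^j` spill over by `< 3s`).  `𝔟ᴺ`'s
(H-U) cost, `huniq`, the identification residual (28 (N4)) stand displayed; which cubes are ON is now a property of `Z′(s)` alone, their NUMBER
(the entropy of the (0.3) sum) is untouched here; nothing of Bałaban's asserted; N21 NOT discharged; counts UNMOVED; count-neutral; one finite
𝕋⁴ at fixed `ε`; NOT ℝ⁴ ∕ OS ∕ mass gap ∕ Clay.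

CITATION HEADER (lean-in-tree rule 2026-08-18).  BY NAME: 30 `collar_mono` ∕ `cover_mem_collar_of_within` ∕ `within_sub_single` ∕ `within_lift_of_blockIter_eq` ∕
`blockIter_cover_sub_single` ∕ `eq_of_shift_eq` ∕ `src_mem_collar_of_inputs_near_Bj`; 29 `exists_of_mem_liftIter` ∕ `fibreIndep_recordStatN_of_numerics` ∕
`fibreIndep_chiSeqN_off_of_numerics`; r11 `B14.Eq216Concrete.liftIter` ∕ `inputs`; `B14.Eq12InteriorLocality.near`; `B14.Eq213DetSet.Bj`; `B14.Eq22Determines.blockIter`;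
`B15Eq112TorusCover.cover` ∕ `lift` ∕ `cover_lift`; `B14.Eq213MaximalDomains.cubeExt`; def-R `Node00.cubeEnl` ∕ `cubeSide` ∕ `cubeIndices` ∕ `RkOfRecord` ∕ `bondsMeeting` ∕
`blockIter` ∕ `fibOfSeq` ∕ `zpOfSeq` ∕ `SeqOfRecord` ∕ `TowerNumerics` ∕ `bgFamOfRecord` ∕ `plaqInside` ∕ `ukBox`; `B14.Eq12InteriorLocality.normalise` ∕ `plaqDetermined_plaqSmall`;
`B14.Eq218Concrete.Seq` ∕ `cubesIn`; `B14SeparationOfRecord.one_le_RkOfRecord`.  Context only (SHAPE, nothing asserted): [Balaban1988Convergent] (1.3) p. 246, (2.5) p. 255, (2.12)–(2.13) p. 256,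
(2.16)–(2.18) p. 257; [Balaban1989LargeFieldI] (0.3) p. 176, (1.1) p. 177.
-/

set_option autoImplicit false

open Set

namespace Summit.QuantumFields.YangMills.Theorems.N21ReadSetDisj

open Literature.MathematicalPhysics.QuantumFieldTheory.Balaban1983to89
open B15DeterminingSets B14.Eq213DetSet B14.Eq216Concrete B14.Eq12InteriorLocality B14.Eq213MaximalDomains B15Eq112TorusCover B14DomainGeom
open B14.Eq22Determines (blockIter blockIter_zero blockIter_succ)
open Summit.QuantumFields.YangMills.Theorems.N21ChiSlotCubeGeometry (exists_of_mem_liftIter)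
open Summit.QuantumFields.YangMills.Theorems.N21ReadSetSupport

variable {P : Params}

/-! ## §4 The read set `liftIter k (inputs (near 𝐁_k(□^{≈4})))` is carried by `□^{≈7}`; the (DISJ) discharge -/

/-- ★ (R1) **EVERY FINE POINT OF THE `k`-BLOCK OF EITHER ENDPOINT OF A READ BOND** of `liftIter k (inputs (near 𝐁_k(Ω)))`,
`Ω = π(cubeExt s c w)`, lies in `π(cubeExt s c (w + 6L^k − 2))` (29 (G6) `exists_of_mem_liftIter` + (F5) + the block spread (B1) + the
`L^k`-translate (B3′)). [cite: Balaban1988Convergent, (1.3) p.246, (2.16) p.257] -/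
theorem block_mem_collar_of_liftIter {k : ℕ} (hk0 : 0 < k) (hk : k ≤ P.m + P.K) {M₁ : ℕ} (hM : 1 ≤ M₁)
    (s : ℕ) (c : Pt P.d) (w : ℤ) {x : PBond P k}
    (hx : x ∈ liftIter k (inputs (near (Bj M₁ (cover P '' cubeExt s c w) k))))
    {z : Site P 0} (hz : blockIter k z = x.src ∨ blockIter k z = x.tgt) :
    z ∈ cover P '' cubeExt s c (w + 6 * ((P.L ^ k : ℕ) : ℤ) - 2) := by
  obtain ⟨b₀, hb₀, rfl⟩ := exists_of_mem_liftIter k _ x hx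
  have hsrc := src_mem_collar_of_inputs_near_Bj hk0 hk hM s c w hb₀
  rw [← cover_lift b₀.src] at hsrc
  have hq : 1 ≤ P.L ^ k := Nat.one_le_pow _ _ P.L_pos
  rcases hz with h | h
  · have hW := within_lift_of_blockIter_eq hk h.symm
    have h1 := cover_mem_collar_of_within s c hsrc hW
    rw [cover_lift] at h1
    exact collar_mono s c (by omega) h1
  · have h' : blockIter k z = (blockIter k b₀.src).shift b₀.dir := h
    have h1 := blockIter_cover_sub_single hk (lift P z) b₀.dir
    rw [cover_lift, h'] at h1
    have hblk : blockIter k b₀.src = blockIter k (cover P (lift P z - Pi.single b₀.dir ((P.L ^ k : ℕ) : ℤ))) :=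
      eq_of_shift_eq h1.symm
    have hW := within_lift_of_blockIter_eq hk hblk
    have h2 := cover_mem_collar_of_within s c hsrc hW
    rw [cover_lift] at h2
    have h3 := cover_mem_collar_of_within s c h2
      ((within_sub_single (lift P z) b₀.dir (t := ((P.L ^ k : ℕ) : ℤ)) (by positivity)).symm)
    rw [cover_lift] at h3
    exact collar_mono s c (by omega) h3

/-- (R2) def-R's `cubeEnl s a n` IS the pushed-forward `n·s`-collar (definitional). [cite: Balaban1988Convergent, (2.16)–(2.17) p.257] -/
theorem cubeEnl_eq (s : ℕ) (a : Pt P.d) (n : ℕ) : Node00.cubeEnl P s a n = cover P '' cubeExt s a ((n * s : ℕ) : ℤ) := rfl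

/-- (R2′) def-R's `Node00.blockIter` IS r11's `B14.Eq22Determines.blockIter` (two spellings of the iterated block map). [cite: Balaban1987RG1, (0.1) p.252] -/
theorem node00_blockIter_eq : ∀ (n : ℕ) (z : Site P 0), Node00.blockIter n z = blockIter n z
  | 0, _ => rfl
  | n + 1, z => by
      rw [blockIter_succ]
      show blockOf (Node00.blockIter n z) = _
      rw [node00_blockIter_eq n z]

/-- ★★ (R3) **THE READ SET OF (2.16) IS CARRIED BY `□^{≈7}`**: for `0 < k ≤ m + K`, `1 ≤ M₁`, `2L^k ≤ s`, every fine point of the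
`k`-block of either endpoint of a bond of `liftIter k (inputs (near 𝐁_k(□_c^{≈4})))` lies in `□_c^{≈7} = cubeEnl s c 7` — the honest
collar for print's *«U_{k,□} depends on V_k restricted to □^{≈4}»*. [cite: Balaban1988Convergent, (2.16) p.257] -/
theorem readSet_block_subset_cubeEnl {k : ℕ} (hk0 : 0 < k) (hk : k ≤ P.m + P.K) {M₁ : ℕ} (hM : 1 ≤ M₁)
    {s : ℕ} (hs : 2 * P.L ^ k ≤ s) (c : Pt P.d) {x : PBond P k}
    (hx : x ∈ liftIter k (inputs (near (Bj M₁ (Node00.cubeEnl P s c 4) k))))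
    {z : Site P 0} (hz : blockIter k z = x.src ∨ blockIter k z = x.tgt) :
    z ∈ Node00.cubeEnl P s c 7 := by
  rw [cubeEnl_eq] at hx ⊢
  exact collar_mono s c (by omega) (block_mem_collar_of_liftIter hk0 hk hM s c _ hx hz)

/-- ★★ (R4) **THE (DISJ) DISCHARGE**: a fibre of def-R's shape `fib ⊆ bondsMeeting k Z` (`fibOfSeq = bondsMeeting k Z′(s)`) MISSES the read
set of every cube whose `□^{≈7}` misses `Z` — file 28 (N1)'s `hdisj` ∕ 22c's, as a theorem of the geometry (`0 < k ≤ m + K`, `1 ≤ M₁`,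
`2L^k ≤ s`). [cite: Balaban1988Convergent, (2.16) p.257; Balaban1989LargeFieldI, (0.3) p.176, (1.1) p.177] -/
theorem not_mem_of_far {k : ℕ} (hk0 : 0 < k) (hk : k ≤ P.m + P.K) {M₁ : ℕ} (hM : 1 ≤ M₁)
    {s : ℕ} (hs : 2 * P.L ^ k ≤ s) (c : Pt P.d) (Z : Set (Site P 0)) (fib : Finset (PBond P k))
    (hfib : ∀ b ∈ fib, b ∈ Node00.bondsMeeting k Z) (hZ : ∀ z ∈ Z, z ∉ Node00.cubeEnl P s c 7) :
    ∀ x ∈ liftIter k (inputs (near (Bj M₁ (Node00.cubeEnl P s c 4) k))), x ∉ fib := by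
  intro x hx hxf
  obtain ⟨z, hzZ, hz⟩ := hfib x hxf
  rw [node00_blockIter_eq] at hz
  exact hZ z hzZ (readSet_block_subset_cubeEnl hk0 hk hM hs c hx hz)

/-! ## §5 At the record: 29 (G5′) ∕ (G5″) with (DISJ) discharged by the geometry -/

section AtRecord

open Literature.MathematicalPhysics.QuantumFieldTheory.Balaban1983to89.Node00
open T4Continuum B14.Eq218Concrete
open Literature.MathematicalPhysics.QuantumFieldTheory.Balaban1983to89.T4DressedR (FibreIndep)
open Literature.MathematicalPhysics.QuantumFieldTheory.Balaban1983to89.T4IndicatorShell (smallInd)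
open Literature.MathematicalPhysics.QuantumFieldTheory.Balaban1983to89.T4LipschitzLedger (Pol)
open Summit.QuantumFields.YangMills.Theorems.N21ChiSlotCubeGeometry (fibreIndep_recordStatN_of_numerics fibreIndep_chiSeqN_off_of_numerics)

variable (F : T4Family) (N : ℕ) [NeZero N]

/-- (A1) The record's cube side `L^{k+1}M₂R_k` is at least `2L^k` once `1 ≤ M₂`. [cite: Balaban1988Convergent, (2.17) p.257 (bookkeeping)] -/
theorem two_mul_pow_le_cubeSide (ν : Stage7Numerics) (g : ℕ → ℝ) (K k : ℕ) (hM₂ : 1 ≤ ν.M₂) :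
    2 * (F.P K).L ^ k ≤ cubeSide (F.P K).L ν.M₂ (RkOfRecord (F.P K).L ν.r (g k)) k := by
  unfold cubeSide
  have hR := B14SeparationOfRecord.one_le_RkOfRecord (F.P K).L_pos ν.r (g k)
  have hL : 2 ≤ (F.P K).L := (F.P K).hL.2
  calc 2 * (F.P K).L ^ k ≤ (F.P K).L * (F.P K).L ^ k * 1 * 1 := by
        rw [mul_one, mul_one]; exact Nat.mul_le_mul_right _ hL
    _ ≤ (F.P K).L ^ (k + 1) * ν.M₂ * RkOfRecord (F.P K).L ν.r (g k) := by
        rw [pow_succ, mul_comm ((F.P K).L ^ k)]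
        exact Nat.mul_le_mul (Nat.mul_le_mul le_rfl hM₂) hR

/-- ★ (A2) **FILE 28 (N1) ∕ 29 (G5′) WITH (DISJ) DISCHARGED**: cube `a`'s block-sup statistic at `𝔟ᴺ` is fibre-independent of every fibre
`fib ⊆ bondsMeeting k Z` as soon as `□_a^{≈7}` misses `Z` — binders left: `0 < k ≤ m + K`, `1 ≤ M₁`, `1 ≤ M₂`, `L·M₁ ≤ L^{k+1}M₂R_k`.
[cite: Balaban1988Convergent, (2.12)–(2.13) p.256, (2.16)–(2.17) p.257; Balaban1989LargeFieldI, (0.3) p.176] -/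
theorem fibreIndep_recordStatN_of_far (ν : Stage7Numerics) (g : ℕ → ℝ) (K k : ℕ) [DecidableEq (PBond (F.P K) k)]
    (hk : k ≤ (F.P K).m + (F.P K).K) (hk0 : 0 < k) (hM : 1 ≤ ν.M₁) (hM₂ : 1 ≤ ν.M₂)
    (hnum : (F.P K).L * ν.M₁ ≤ cubeSide (F.P K).L ν.M₂ (RkOfRecord (F.P K).L ν.r (g k)) k)
    (a : ↥(cubeIndices (F.P K) (cubeSide (F.P K).L ν.M₂ (RkOfRecord (F.P K).L ν.r (g k)) k)))
    (Z : Set (Site (F.P K) 0)) (fib : Finset (PBond (F.P K) k)) (hfib : ∀ b ∈ fib, b ∈ bondsMeeting k Z)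
    (hZ : ∀ z ∈ Z, z ∉ cubeEnl (F.P K) (cubeSide (F.P K).L ν.M₂ (RkOfRecord (F.P K).L ν.r (g k)) k) a 7) :
    FibreIndep fib fun V : GaugeField (F.P K) k (SU N) =>
      ⨆ p : ↥(plaqInside (cubeEnl (F.P K) (cubeSide (F.P K).L ν.M₂ (RkOfRecord (F.P K).L ν.r (g k)) k) a 1)),
        dist1 (GaugeField.plaqHol (ukBox (normalise (bgFamOfRecord F N ν K k) (plaqDetermined_plaqSmall _)) ν.M₁
          (cubeEnl (F.P K) (cubeSide (F.P K).L ν.M₂ (RkOfRecord (F.P K).L ν.r (g k)) k) a 4) k V) p.1) :=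
  fibreIndep_recordStatN_of_numerics F N ν g K k hk hk0 hM hnum a fib
    (not_mem_of_far hk0 hk hM (two_mul_pow_le_cubeSide F ν g K k hM₂) a.1 Z fib hfib hZ)

/-- ★★ (A3) **KT-28's (LOC) AT `𝔟ᴺ` MODULO NUMERICS ONLY** (29 (G5″) with `hoff` discharged): for every fibre `fib ⊆ bondsMeeting k Z`, every
polarity and threshold vector, the product of χ-slots over the cubes of `Ω_k(s)` outside a set `On` CONTAINING EVERY CUBE WHOSE `□^{≈7}` MEETS
`Z` is fibre-independent of `fib` — binders left: `0 < k ≤ m + K`, `1 ≤ M₁`, `1 ≤ M₂`, `L·M₁ ≤ L^{k+1}M₂R_k`.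
[cite: Balaban1988Convergent, (2.16)–(2.18) p.257; Balaban1989LargeFieldI, (0.3) p.176, (1.1) p.177] -/
theorem fibreIndep_chiSeqN_off_of_far (ν : Stage7Numerics) (g : ℕ → ℝ) (K k : ℕ) [DecidableEq (PBond (F.P K) k)]
    (hk : k ≤ (F.P K).m + (F.P K).K) (hk0 : 0 < k) (hM : 1 ≤ ν.M₁) (hM₂ : 1 ≤ ν.M₂)
    (hnum : (F.P K).L * ν.M₁ ≤ cubeSide (F.P K).L ν.M₂ (RkOfRecord (F.P K).L ν.r (g k)) k)
    (Z : Set (Site (F.P K) 0)) (fib : Finset (PBond (F.P K) k)) (hfib : ∀ b ∈ fib, b ∈ bondsMeeting k Z)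
    {D : ℕ → Set (Set (Site (F.P K) 0))} (s : Seq D k)
    (On : Finset ↥(cubeIndices (F.P K) (cubeSide (F.P K).L ν.M₂ (RkOfRecord (F.P K).L ν.r (g k)) k)))
    (hOn : ∀ c : ↥(cubeIndices (F.P K) (cubeSide (F.P K).L ν.M₂ (RkOfRecord (F.P K).L ν.r (g k)) k)), c ∉ On →
      ∀ z ∈ Z, z ∉ cubeEnl (F.P K) (cubeSide (F.P K).L ν.M₂ (RkOfRecord (F.P K).L ν.r (g k)) k) c 7)
    (pol : ↥(cubeIndices (F.P K) (cubeSide (F.P K).L ν.M₂ (RkOfRecord (F.P K).L ν.r (g k)) k)) → Pol)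
    (S : ↥(cubeIndices (F.P K) (cubeSide (F.P K).L ν.M₂ (RkOfRecord (F.P K).L ν.r (g k)) k)) → ℝ) :
    FibreIndep fib fun V : GaugeField (F.P K) k (SU N) =>
      ∏ c ∈ (cubesIn (fun a : ↥(cubeIndices (F.P K) (cubeSide (F.P K).L ν.M₂ (RkOfRecord (F.P K).L ν.r (g k)) k)) =>
          cubeEnl (F.P K) (cubeSide (F.P K).L ν.M₂ (RkOfRecord (F.P K).L ν.r (g k)) k) a 0) (s.Ω k)).filter (fun c => c ∉ On),
        (pol c).fac (smallInd (⨆ p : ↥(plaqInside (cubeEnl (F.P K) (cubeSide (F.P K).L ν.M₂ (RkOfRecord (F.P K).L ν.r (g k)) k) c 1)),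
          dist1 (GaugeField.plaqHol (ukBox (normalise (bgFamOfRecord F N ν K k) (plaqDetermined_plaqSmall _)) ν.M₁
            (cubeEnl (F.P K) (cubeSide (F.P K).L ν.M₂ (RkOfRecord (F.P K).L ν.r (g k)) k) c 4) k V) p.1)) (S c)) :=
  fibreIndep_chiSeqN_off_of_numerics F N ν g K k hk hk0 hM hnum fib s On
    (fun c _ hc => not_mem_of_far hk0 hk hM (two_mul_pow_le_cubeSide F ν g K k hM₂) c.1 Z fib hfib (hOn c hc)) pol S

/-- (A4) def-R's fibre bond set of a sequence IS a fibre of the shape `⊆ bondsMeeting k Z′(s)` (definitional unfolding of `fibOfSeq`).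
[cite: Balaban1989LargeFieldI, (0.3) p.176, (1.1) p.177] -/
theorem mem_bondsMeeting_of_mem_fibOfSeq (ν : Stage7Numerics) (τ : TowerNumerics) (p : B12.RunParams) (g : ℕ → ℝ) (k : ℕ)
    (sq : SeqOfRecord F ν τ.M g p.K k) {b : PBond (F.P p.K) k} (hb : b ∈ fibOfSeq F ν τ p g k sq) :
    b ∈ bondsMeeting k (zpOfSeq F ν τ g p.K k sq) := by
  classical
  unfold fibOfSeq at hb
  exact (Finset.mem_filter.1 hb).2

/-- ★★ (A5) **ONE APPLICATION AT def-R's FIBRE**: (A3) with `fib := fibOfSeq F ν τ p g k sq` — the `T^{(k)}`-bond variables over which (0.3) integrates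
for the large-field sequence `sq` — and `Z := Z′(sq) = zpOfSeq …`: the product of χ-slots over the cubes of `Ω_k(s)` outside any `On` containing the
cubes whose `□^{≈7}` meets `Z′(sq)` is independent of the (0.3) fibre variables (binders: `0 < k ≤ m + K`, `1 ≤ M₁`, `1 ≤ M₂`, `L·M₁ ≤ L^{k+1}M₂R_k`).
[cite: Balaban1988Convergent, (2.16)–(2.18) p.257; Balaban1989LargeFieldI, (0.3) p.176, (1.1) p.177] -/
theorem fibreIndep_chiSeqN_off_of_far_fibOfSeq (ν : Stage7Numerics) (τ : TowerNumerics) (p : B12.RunParams) (g : ℕ → ℝ) (k : ℕ)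
    [DecidableEq (PBond (F.P p.K) k)]
    (hk : k ≤ (F.P p.K).m + (F.P p.K).K) (hk0 : 0 < k) (hM : 1 ≤ ν.M₁) (hM₂ : 1 ≤ ν.M₂)
    (hnum : (F.P p.K).L * ν.M₁ ≤ cubeSide (F.P p.K).L ν.M₂ (RkOfRecord (F.P p.K).L ν.r (g k)) k)
    (sq : SeqOfRecord F ν τ.M g p.K k) {D : ℕ → Set (Set (Site (F.P p.K) 0))} (s : Seq D k)
    (On : Finset ↥(cubeIndices (F.P p.K) (cubeSide (F.P p.K).L ν.M₂ (RkOfRecord (F.P p.K).L ν.r (g k)) k)))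
    (hOn : ∀ c : ↥(cubeIndices (F.P p.K) (cubeSide (F.P p.K).L ν.M₂ (RkOfRecord (F.P p.K).L ν.r (g k)) k)), c ∉ On →
      ∀ z ∈ zpOfSeq F ν τ g p.K k sq, z ∉ cubeEnl (F.P p.K) (cubeSide (F.P p.K).L ν.M₂ (RkOfRecord (F.P p.K).L ν.r (g k)) k) c 7)
    (pol : ↥(cubeIndices (F.P p.K) (cubeSide (F.P p.K).L ν.M₂ (RkOfRecord (F.P p.K).L ν.r (g k)) k)) → Pol)
    (S : ↥(cubeIndices (F.P p.K) (cubeSide (F.P p.K).L ν.M₂ (RkOfRecord (F.P p.K).L ν.r (g k)) k)) → ℝ) :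
    FibreIndep (fibOfSeq F ν τ p g k sq) fun V : GaugeField (F.P p.K) k (SU N) =>
      ∏ c ∈ (cubesIn (fun a : ↥(cubeIndices (F.P p.K) (cubeSide (F.P p.K).L ν.M₂ (RkOfRecord (F.P p.K).L ν.r (g k)) k)) =>
          cubeEnl (F.P p.K) (cubeSide (F.P p.K).L ν.M₂ (RkOfRecord (F.P p.K).L ν.r (g k)) k) a 0) (s.Ω k)).filter (fun c => c ∉ On),
        (pol c).fac (smallInd (⨆ q : ↥(plaqInside (cubeEnl (F.P p.K) (cubeSide (F.P p.K).L ν.M₂ (RkOfRecord (F.P p.K).L ν.r (g k)) k) c 1)),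
          dist1 (GaugeField.plaqHol (ukBox (normalise (bgFamOfRecord F N ν p.K k) (plaqDetermined_plaqSmall _)) ν.M₁
            (cubeEnl (F.P p.K) (cubeSide (F.P p.K).L ν.M₂ (RkOfRecord (F.P p.K).L ν.r (g k)) k) c 4) k V) q.1)) (S c)) :=
  fibreIndep_chiSeqN_off_of_far F N ν g p.K k hk hk0 hM hM₂ hnum (zpOfSeq F ν τ g p.K k sq) (fibOfSeq F ν τ p g k sq)
    (fun _ hb => mem_bondsMeeting_of_mem_fibOfSeq F ν τ p g k sq hb) s On hOn pol S

end AtRecord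

end Summit.QuantumFields.YangMills.Theorems.N21ReadSetDisj
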